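import Literature.GroupTheory.CombinatorialGroupTheory.FreeGroupHandleAmalgam
import Literature.GroupTheory.CombinatorialGroupTheory.AmalgamDiscrimination
import Literature.GroupTheory.CombinatorialGroupTheory.FreeGroupIndexTwoEmbedding
import Literature.GroupTheory.CombinatorialGroupTheory.FreeGroupBigPowers
import Literature.Topology.FourManifolds.SurfaceGroupGenusOne
import Mathlib.Logic.Equiv.Bool
import HarnessLib

/-!
# `π₁` of a once-bordered surface is discriminated by maps to `F₂` fixing the boundary (Baumslag)

Topic `Literature/GroupTheory/CombinatorialGroupTheory`; theorems only.  Write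
`F⟨p, q⟩ = FreeGroup Bool` (`p = of true`, `q = of false`), `z = [p, q] = p q p⁻¹ q⁻¹`, and
`r_h = ∏_{i<h} [aᵢ, bᵢ] ∈ F_{2h} = FreeGroup (surfaceGen h)` (the boundary word of the once-bordered
surface of genus `h`).

* `freeGroup_surfaceGen_discriminated` — **for every `h ≥ 1` and every finite list of
  non-trivial elements of `F_{2h}` there is a homomorphism `α : F_{2h} → F⟨p,q⟩` with
  `α(r_h) = z` killing none of them**, using Baumslag's big powers property of `z` (G. Baumslag
  1962 Prop. 1; `FreeGroupBigPowers.lean`, `bigPowers_pq`).  Induction on `h`: `F_{2h+2} =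
  F_{2h} *_{r_h = c} F⟨c, a, b⟩` (`FreeGroupHandleAmalgam.lean`); the factor `F⟨c,a,b⟩` embeds by
  `γ : c ↦ z, a ↦ q, b ↦ p²` (`FreeGroupIndexTwoEmbedding.lean`); the combination lemma
  (`AmalgamDiscrimination.lean`) gives a twisted lift killing nothing on the list, under which
  `r_{h+1} = r_h · [a,b] ↦ (zᵐ p) z⁻¹ (zᵐ p)⁻¹`; conjugating back and swapping `p ↔ q` renormalises
  the boundary value to `z`.  This is the heart of G. Baumslag's theorem that surface groups are
  residually free (*On generalised free products*, Math. Z. 78 (1962), Thm. 1 and §4).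

## References

* G. Baumslag, *On generalised free products*, Math. Z. 78 (1962), Thm. 1, §4. [Baumslag1962]
* R. C. Lyndon, P. E. Schupp, *Combinatorial Group Theory*, Springer (1977); Classics in
  Mathematics (2001), Ch. I §7. [LyndonSchupp2001]
-/

noncomputable section

namespace Literature.GroupTheory.CombinatorialGroupTheory

open Literature.Topology.FourManifolds Monoid Monoid.PushoutI

/-- `z = [p, q]` in `F⟨p, q⟩ = FreeGroup Bool`. -/
local notation3 "𝔷" => (FreeGroup.of true * FreeGroup.of false * (FreeGroup.of true)⁻¹ *
  (FreeGroup.of false)⁻¹ : FreeGroup Bool)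

/-- The handle homomorphism `γ : F⟨c,a,b⟩ → F⟨p,q⟩` of `FreeGroupIndexTwoEmbedding.lean`. -/
local notation3 "γ" => (FreeGroup.lift fun o : Option (surfaceGen 1) =>
  Option.elim o (FreeGroup.of true * FreeGroup.of false * (FreeGroup.of true)⁻¹ * (FreeGroup.of false)⁻¹)
    (fun x => bif x.2 then FreeGroup.of true * FreeGroup.of true else FreeGroup.of false) :
      FreeGroup (Option (surfaceGen 1)) →* FreeGroup Bool)

/-- `z = [p, q] ≠ 1`. [cite: Baumslag1962, Thm. 1] -/
theorem commutator_pq_ne_one : (𝔷) ≠ 1 := by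
  intro h
  have := congrArg FreeGroup.toWord h
  rw [FreeGroup.toWord_one] at this
  simp [FreeGroup.toWord_mul, FreeGroup.toWord_inv, FreeGroup.toWord_of, FreeGroup.invRev,
    FreeGroup.reduce.cons, FreeGroup.reduce_nil] at this

/-- **The big powers property of `z = [p, q]`** in `F⟨p, q⟩` (Baumslag), in the alternating shape
consumed by the combination lemma `Amalgam.exists_twistLift_forall_ne_one`. [cite: Baumslag1962, Prop. 1] -/
theorem bigPowers_pq : ∀ (c : ℤ) (ys : List (Bool × FreeGroup Bool)), ys ≠ [] →
    ys.IsChain (fun a b => a.1 ≠ b.1) → (∀ y ∈ ys, ¬ Commute y.2 𝔷) →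
    ∃ N : ℕ, ∀ m : ℤ, (N : ℤ) ≤ |m| →
      𝔷 ^ c * (ys.map fun y => 𝔷 ^ (m * (y.1.toNat : ℤ)) * y.2 * 𝔷 ^ (-(m * (y.1.toNat : ℤ)))).prod ≠ 1 :=
  fun c ys hne halt hy => FreeGroup.exists_bigPowers_alternating _ commutator_pq_ne_one c ys hne halt hy

/-- **Genus one**: `F⟨a₁, b₁⟩ → F⟨p, q⟩`, `a₁ ↦ p`, `b₁ ↦ q` is injective and sends `r₁ = [a₁,b₁]` to
`z`. [cite: Baumslag1962, §4] -/
theorem exists_hom_genus_one (L : List (FreeGroup (surfaceGen 1))) (hL : ∀ x ∈ L, x ≠ 1) :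
    ∃ α : FreeGroup (surfaceGen 1) →* FreeGroup Bool, α (surfaceRelator 1) = 𝔷 ∧ ∀ x ∈ L, α x ≠ 1 := by
  let α : FreeGroup (surfaceGen 1) →* FreeGroup Bool := FreeGroup.lift fun x => FreeGroup.of (!x.2)
  let β : FreeGroup Bool →* FreeGroup (surfaceGen 1) := FreeGroup.lift fun b => FreeGroup.of (0, !b)
  have hβα : β.comp α = MonoidHom.id _ := by
    refine FreeGroup.ext_hom _ _ fun x => ?_
    obtain ⟨i, b⟩ := x
    have hi : i = 0 := Subsingleton.elim _ _
    subst hi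
    simp [α, β]
  refine ⟨α, ?_, fun x hx h => hL x hx ?_⟩
  · rw [surfaceRelator_one]
    simp [α, genA, genB]
  · have := congrArg β h
    rwa [map_one, ← MonoidHom.comp_apply, hβα, MonoidHom.id_apply] at this

/-- **Discrimination of `F_{2h}` relative to the boundary word**: for `h ≥ 1` and any finite list
of non-trivial elements of `F_{2h}` there is `α : F_{2h} → F⟨p,q⟩` with `α(r_h) = z` killing none of
them. [cite: Baumslag1962, Thm. 1] -/
theorem freeGroup_surfaceGen_discriminated
    {h : ℕ} (hh : 1 ≤ h) :
    ∀ (L : List (FreeGroup (surfaceGen h))), (∀ x ∈ L, x ≠ 1) →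
      ∃ α : FreeGroup (surfaceGen h) →* FreeGroup Bool, α (surfaceRelator h) = 𝔷 ∧ ∀ x ∈ L, α x ≠ 1 := by
  induction h, hh using Nat.le_induction with
  | base => exact exists_hom_genus_one
  | succ h hh ih =>
    intro L hL
    obtain ⟨e, he₁, he₂⟩ := exists_freeGroup_mulEquiv_handleAmalgam h
    -- the families: all `α` with `α(r_h) = z` on the first factor, `γ` on the handle
    let 𝓕 : ∀ b : Bool, (FreeGroup (HandleFactorGen h b) →* FreeGroup Bool) → Prop := fun b =>
      Bool.rec (motive := fun b => (FreeGroup (HandleFactorGen h b) →* FreeGroup Bool) → Prop)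
        (fun α => α (surfaceRelator h) = 𝔷) (fun β => β = γ) b
    have h𝓕 : ∀ b f, 𝓕 b f → f.comp (handleAmalgamHom h b) = zpowersHom _ 𝔷 := by
      intro b f hf
      refine MonoidHom.ext_mint ?_
      cases b with
      | false =>
        change f (surfaceRelator h ^ Multiplicative.toAdd (Multiplicative.ofAdd (1 : ℤ))) =
          𝔷 ^ Multiplicative.toAdd (Multiplicative.ofAdd (1 : ℤ))
        rw [toAdd_ofAdd, zpow_one, zpow_one]
        exact hf
      | true =>
        change f (FreeGroup.of none ^ Multiplicative.toAdd (Multiplicative.ofAdd (1 : ℤ))) =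
          𝔷 ^ Multiplicative.toAdd (Multiplicative.ofAdd (1 : ℤ))
        rw [toAdd_ofAdd, zpow_one, zpow_one, show f = γ from hf, FreeGroup.lift_apply_of]
        rfl
    have hdisc : ∀ (b : Bool) (L' : List (FreeGroup (HandleFactorGen h b))), (∀ x ∈ L', x ≠ 1) →
        ∃ f, 𝓕 b f ∧ ∀ x ∈ L', f x ≠ 1 := by
      intro b L' hL'
      cases b with
      | false => exact ih L' hL'
      | true =>
        refine ⟨γ, rfl, fun x hx hx1 => hL' x hx (handleHom_injective ?_)⟩
        rw [hx1, map_one]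
    -- the combination lemma
    obtain ⟨f, hfF, hf, m, hΦ⟩ := Amalgam.exists_twistLift_forall_ne_one
      (handleAmalgamHom_injective hh) 𝔷 commutator_pq_ne_one bigPowers_pq
      (handleAmalgam_commutator_ne_one hh) 𝓕 h𝓕 hdisc (L.map e) (by
        intro s hs
        obtain ⟨x, hx, rfl⟩ := List.mem_map.1 hs
        exact fun h0 => hL x hx (e.injective (h0.trans (map_one e).symm)))
    -- renormalisation: conjugate by `(zᵐ p)⁻¹` and swap `p ↔ q`
    let σ : FreeGroup Bool ≃* FreeGroup Bool := FreeGroup.freeGroupCongr Equiv.boolNot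
    let ρ : FreeGroup Bool ≃* FreeGroup Bool := MulAut.conj ((𝔷 ^ m * FreeGroup.of true)⁻¹)
    let Φ := PushoutI.lift (fun b => (f b).comp
        (MulAut.conj (handleAmalgamHom h b (Multiplicative.ofAdd (m * (b.toNat : ℤ))))).toMonoidHom)
      (zpowersHom _ 𝔷) (Amalgam.twist_compat f 𝔷 hf m)
    refine ⟨(σ.toMonoidHom.comp ρ.toMonoidHom).comp (Φ.comp e.toMonoidHom), ?_, ?_⟩
    · -- the boundary word
      have hr : e (surfaceRelator (h + 1)) =
          PushoutI.of (φ := handleAmalgamHom h) false (surfaceRelator h) *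
            PushoutI.of (φ := handleAmalgamHom h) true (FreeGroup.map some (surfaceRelator 1)) := by
        rw [surfaceRelator_add h 1, map_mul]
        exact congrArg₂ (· * ·) (DFunLike.congr_fun he₁ (surfaceRelator h))
          (DFunLike.congr_fun he₂ (surfaceRelator 1))
      have h1 : Φ (PushoutI.of (φ := handleAmalgamHom h) false (surfaceRelator h)) = 𝔷 := by
        have := Amalgam.twistLift_of f 𝔷 hf m false (surfaceRelator h)
        simp only [Bool.toNat_false, Nat.cast_zero, mul_zero, zpow_zero, one_mul, neg_zero, mul_one] at this
        rw [this]
        exact hfF false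
      have h2 : Φ (PushoutI.of (φ := handleAmalgamHom h) true (FreeGroup.map some (surfaceRelator 1))) =
          𝔷 ^ m * (FreeGroup.of false * (FreeGroup.of true * FreeGroup.of true) * (FreeGroup.of false)⁻¹ *
            (FreeGroup.of true * FreeGroup.of true)⁻¹) * 𝔷 ^ (-m) := by
        have := Amalgam.twistLift_of f 𝔷 hf m true (FreeGroup.map some (surfaceRelator 1))
        simp only [Bool.toNat_true, Nat.cast_one, mul_one] at this
        rw [this, show f true = γ from hfF true, surfaceRelator_one]
        simp [genA, genB, FreeGroup.map.of]
      change σ (ρ (Φ (e (surfaceRelator (h + 1))))) = 𝔷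
      have hρ : ∀ x, ρ x = (𝔷 ^ m * FreeGroup.of true)⁻¹ * x * (𝔷 ^ m * FreeGroup.of true)⁻¹⁻¹ :=
        fun _ => rfl
      have hσt : σ (FreeGroup.of true) = FreeGroup.of false := rfl
      have hσf : σ (FreeGroup.of false) = FreeGroup.of true := rfl
      rw [hr, map_mul, h1, h2, hρ]
      simp only [map_mul, map_inv, map_zpow, hσt, hσf]
      group
    · intro x hx hx0
      apply hΦ (e x) (List.mem_map.2 ⟨x, hx, rfl⟩)
      have : σ (ρ (Φ (e x))) = 1 := hx0
      rwa [EmbeddingLike.map_eq_one_iff, EmbeddingLike.map_eq_one_iff] at this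

end Literature.GroupTheory.CombinatorialGroupTheory
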